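import Summits.QuantumFields.BalabanUV.T4Continuum.Support.NE7InvariantFunctionalLetter
import Summits.QuantumFields.BalabanUV.T4Continuum.Support.NE3FineCriticalGeneral
import Summits.QuantumFields.BalabanUV.T4Continuum.Support.NE3CpushGaugeCovariance
import Summits.QuantumFields.BalabanUV.T4Continuum.Support.NE3CovariantCalculus
import Summits.QuantumFields.BalabanUV.T4Continuum.Support.NE3LandauOrbit
import Summits.QuantumFields.BalabanUV.T4Continuum.Support.NE3FrameFreeDecompositionPrep
import Summits.QuantumFields.BalabanUV.T4Continuum.Support.NE3CovariantAdjointTorus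
import Summits.QuantumFields.BalabanUV.T4Continuum.Support.NE3EnergyHessBilin
import Mathlib.LinearAlgebra.Projection
import HarnessLib

/-!
# NE7SymmetricFermat — FERMAT FOR A SYMMETRIC RESTRICTED MINIMISER: a configuration `V` fixed by a set `𝒦` of unitary periodic gauge transformations which
# minimises the fine Wilson action of the period only among the `𝒦`-FIXED competitors on its constraint fibre is critical along every `𝒦`-INVARIANT
# constraint-tangent direction — `NE3FineCriticalGeneral.hasDerivAt_fineAction_vary_of_isLocalMin` re-run on the `𝒦`-fixed subspace of the torus chart

Cell `pub-balaban`, rung (B)+1 sub-cell t4, lineage `b2b-balaban-t4-ne7b-p1` (row NE7b OWNER + CRUX PROVER; junction service for row NE7, ruling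
R-OWNER-149-1 (2)), generation 158.  File 4 of the junction census of ROAD-G114 §8's STABILISER DESIGN ISSUE (files 1–3: `NE7InvariantFunctionalLetter`,
`NE7SymmetricCriticality`, `NE7SymmetricAdmissibleWitness`).
THE ARGUMENT.  Same data as NE3-R2's Fermat (`V` unitary `L·M`-periodic small, a constraint `Q` through the average into a finite-dimensional `G`, strictly
differentiable in the coarse chart with differential `Q′` onto from the skew directions, a side condition `Near`), plus: a set `𝒦` of unitary `L·M`-periodic
site fields fixing `V`; an isometric linear action `R` of `𝒦` on `(G, B_G)` under which the chart constraint `F(θ) = Q(cavg(chart_V θ))` is EQUIVARIANT near `0`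
for the dressing `θ^g(r,κ) = Ad_{g(boxVec r + e_κ)} θ(r,κ)` of the chart parameter (`chart_V(θ^g) = (chart_V θ)^g` since `g` fixes `V`); and minimality of `V`
among the `𝒦`-FIXED competitors only.  On the fixed subspace `E^𝒦` of the chart the competitors `chart_V θ` are `𝒦`-fixed, the constraint lands in the
fixed subspace `G^𝒦` (projected there by a linear projection `P`, the identity on `G^𝒦`), and the restricted differential `P ∘ F′ ∘ ι` is ONTO `G^𝒦` by
`NE7InvariantFunctionalLetter.exists_fixed_preimage_of_equivariant` (equivariance of `F′` from that of `F` by uniqueness of derivatives; the Frobenius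
form on the chart, `B_G` on `G`).  `AveragingDeficitFermat.fermat_of_submersion` on `E^𝒦` then kills the action differential on every `𝒦`-invariant tangent
direction.
WHAT ([folklore]; 0 def, 0 sorry; every `d`, every `U(n)`).  §1 `skewP_Ad` (with `NE3CovariantAdjointTorus.conjTranspose_Ad`), `site_periodic_wrap`, `chartDir_dress`, **`chart_dress`**
(`chart_V(θ^g) = (chart_V θ)^g`); §2 **`hasDerivAt_fineAction_vary_of_isLocalMin_symmetric`**.
HONEST FRAMING (page 1): soft calculus (Lagrange on a submersion) + finite-dimensional linear algebra over NE3-R2's torus chart; no estimate; nothing of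
Bałaban's asserted; NOT NE7, NOT NE3, row NE7b NOT PRINTED ∕ NOT PROVED; spine 0∕9; finite T⁴ rung (B)+1 — NOT infinite volume, NOT mass gap, NOT BetaPertH,
NOT Clay (continuum YM on T⁴ ⇐ BetaPertH ∧ nine spine estimates).
-/

set_option autoImplicit false

open scoped BigOperators Matrix Matrix.Norms.L2Operator Topology
open NormedSpace Finset Filter

namespace Summit.QuantumFields.BalabanUV.T4Continuum.NE7SymmetricFermat

open Literature.MathematicalPhysics.QuantumFieldTheory.Balaban1983to89
open B7Prop1Explicit B7Prop2Explicit MatrixLog UnitaryModel MatrixNorms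
open T4AveragingDeficitWall hiding Site Plane Plaq Bond
open T4AveragingDeficitWallBoundary (IsPeriodicCfg periodBox)
open AveragingDeficitTransport AveragingDeficitPlaqDeriv AveragingDeficitSideDeriv AveragingDeficitPeriodicCounting
open AveragingDeficitResidualPairing AveragingDeficitFaceWords AveragingDeficitFaceLift
open AveragingDeficitLiftPeriodic
open AveragingDeficitTorusChart AveragingDeficitChartCalculus
open AveragingDeficitFermat
open AveragingDeficitNearIdentity (Ad_add Ad_smul Ad_zero)
open AveragingDeficitLocality (expUnit_Ad)
open NE3EnergyShapes (IsUnitarySite IsPeriodicSite)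
open NE3EnergyHessBilin (Ad_real_smul)
open NE3CpushGaugeCovariance (vary_gaugeAct)
open NE3CovariantCalculus (hsR hsR_self hsR_add_left hsR_add_right hsR_Ad)
open NE3FrameFreeDecompositionPrep (hsR_smul_left hsR_smul_right)
open NE3LandauOrbit (eq_zero_of_nhsNormSq_eq_zero)
open NE7InvariantFunctionalLetter (exists_fixed_preimage_of_equivariant)
open NE3CovariantAdjointTorus (conjTranspose_Ad)

noncomputable section

variable {d : ℕ} {n : Type*} [Fintype n] [DecidableEq n]

/-! ## §1 The dressing of the chart parameter by a gauge transformation fixing the base -/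

/-- The retraction onto `𝔲(N)` commutes with unitary conjugation: `skewP (Ad_u X) = Ad_u (skewP X)`. [folklore] -/
theorem skewP_Ad {u : (Matrix n n ℂ)ˣ} (hu : u ∈ unitaryUnits (Matrix n n ℂ)) (X : Matrix n n ℂ) : skewP (Ad u X) = Ad u (skewP X) := by
  have hsub : Ad u (X - Xᴴ) = Ad u X - Ad u Xᴴ := by unfold Ad; rw [mul_sub, sub_mul]
  rw [skewP_apply, skewP_apply, Matrix.star_eq_conjTranspose, Matrix.star_eq_conjTranspose, conjTranspose_Ad hu, ← hsub, Ad_smul]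

/-- A periodic site field read at a wrapped site: `g (boxVec N (redN N x) + e κ) = g (x + e κ)`. [folklore] -/
theorem site_periodic_wrap (N : ℕ) [NeZero N] {g : Site d → (Matrix n n ℂ)ˣ} (hgP : IsPeriodicSite g (N : ℤ)) (x : Site d) (κ : Fin d) :
    g (boxVec N (redN N x) + e κ) = g (x + e κ) := by
  have h := eq_wrap_add N x
  have h2 : x + e κ = (boxVec N (redN N x) + e κ) + (N : ℤ) • (fun i => x i / (N : ℤ)) := by
    conv_lhs => rw [h]
    abel
  rw [h2, periodic_smul_vec (f := g) hgP]

/-- **THE CHART DIRECTION OF THE DRESSED PARAMETER IS THE DRESSED CHART DIRECTION**: for `g` unitary `N`-periodic,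
`chartDir skewP N θ^g = (chartDir skewP N θ)^g`, `θ^g(r,κ) = Ad_{g(boxVec r + e_κ)} θ(r,κ)`, `ψ^g(x,κ) = Ad_{g(x+e_κ)} ψ(x,κ)`. [folklore] -/
theorem chartDir_dress (N : ℕ) [NeZero N] {g : Site d → (Matrix n n ℂ)ˣ} (hgu : IsUnitarySite g) (hgP : IsPeriodicSite g (N : ℤ)) (θ : TDir d n N) :
    chartDir skewP N (fun r κ => Ad (g (boxVec N r + e κ)) (θ r κ)) = fun x κ => Ad (g (x + e κ)) (chartDir skewP N θ x κ) := by
  funext x κ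
  simp only [chartDir]
  rw [skewP_Ad (hgu _), site_periodic_wrap N hgP]

/-- **THE CHART IS EQUIVARIANT AT A FIXED BASE**: if `g` is unitary, `N`-periodic and fixes `V`, then `chart skewP N V θ^g = (chart skewP N V θ)^g`. [folklore] -/
theorem chart_dress (N : ℕ) [NeZero N] {V : Site d → Fin d → (Matrix n n ℂ)ˣ} {g : Site d → (Matrix n n ℂ)ˣ} (hgu : IsUnitarySite g)
    (hgP : IsPeriodicSite g (N : ℤ)) (hfix : gaugeAct g V = V) (θ : TDir d n N) :
    chart skewP N V (fun r κ => Ad (g (boxVec N r + e κ)) (θ r κ)) = gaugeAct g (chart skewP N V θ) := by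
  rw [chart_eq_vary_one, chart_eq_vary_one, chartDir_dress N hgu hgP]
  have h := vary_gaugeAct g V (chartDir skewP N θ) 1
  rwa [hfix] at h

/-! ## §2 Fermat for a symmetric restricted minimiser -/

/-- **FERMAT FOR A SYMMETRIC RESTRICTED MINIMISER ALONG EVERY INVARIANT TANGENT DIRECTION.**  Hypotheses of
`NE3FineCriticalGeneral.hasDerivAt_fineAction_vary_of_isLocalMin` (`V` unitary of period `L·M`, `SmallField V a`, `liftSmall d L·a ≤ 1`; a constraint `Q` into a
finite-dimensional `G`, strictly differentiable in the coarse chart at `cavg L V` with differential `Q′` onto from the skew directions; a side condition `Near`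
holding near `V` in the chart), and moreover: `𝒦` a set of unitary `L·M`-periodic site fields fixing `V`; a positive-definite form `B_G` on `G` and `B_G`-isometries
`R g` (`g ∈ 𝒦`) under which the chart constraint is equivariant near `0` (`Q(cavg(chart_V θ^g)) = R g (Q(cavg(chart_V θ)))`); and minimality of `V` among the
`𝒦`-FIXED unitary periodic `Near` competitors `U` with `Q(cavg U) = Q(cavg V)`.  THEN for every skew `L·M`-periodic `𝒦`-INVARIANT `ψ` with
`Q′(resDir M (pushDir L V ψ ∘ L•)) = 0`: `HasDerivAt (s ↦ A_fine(V e^{sψ})) 0 0`. [folklore] -/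
theorem hasDerivAt_fineAction_vary_of_isLocalMin_symmetric [Nonempty n] {L M : ℕ} [NeZero L] [NeZero M] {V : Site d → Fin d → (Matrix n n ℂ)ˣ}
    (hV : IsUnitaryCfg V) (hVP : IsPeriodicCfg V ((L : ℤ) * M)) {a : ℝ} (ha : 0 ≤ a)
    (hsmall : liftSmall d L * a ≤ 1) (hVa : SmallField V a)
    {G : Type*} [NormedAddCommGroup G] [NormedSpace ℝ G] [FiniteDimensional ℝ G]
    (Q : (Site d → Fin d → (Matrix n n ℂ)ˣ) → G) (Q' : TDir d n M →L[ℝ] G)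
    (hQ : HasStrictFDerivAt (fun Φ : TDir d n M => Q (chart (ContinuousLinearMap.id ℝ (Matrix n n ℂ)) M (cavg L V) Φ)) Q' 0)
    (hQ' : ∀ γ : G, ∃ Φ : TDir d n M, (∀ r κ, Φ r κ ∈ skewAdjoint (Matrix n n ℂ)) ∧ Q' Φ = γ)
    (𝒦 : Set (Site d → (Matrix n n ℂ)ˣ)) (h𝒦u : ∀ g ∈ 𝒦, IsUnitarySite g) (h𝒦P : ∀ g ∈ 𝒦, IsPeriodicSite g ((L * M : ℕ) : ℤ))
    (h𝒦fix : ∀ g ∈ 𝒦, gaugeAct g V = V)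
    (BG : G →ₗ[ℝ] G →ₗ[ℝ] ℝ) (hBG : ∀ γ : G, γ ≠ 0 → 0 < BG γ γ)
    (R : (Site d → (Matrix n n ℂ)ˣ) → G →L[ℝ] G) (hR : ∀ g ∈ 𝒦, ∀ γ γ' : G, BG (R g γ) (R g γ') = BG γ γ')
    (hQR : ∀ᶠ θ in 𝓝 (0 : TDir d n (L * M)), ∀ g ∈ 𝒦,
      Q (cavg L (chart skewP (L * M) V (fun r κ => Ad (g (boxVec (L * M) r + e κ)) (θ r κ)))) = R g (Q (cavg L (chart skewP (L * M) V θ))))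
    (Near : (Site d → Fin d → (Matrix n n ℂ)ˣ) → Prop) (hNear : ∀ᶠ θ in 𝓝 (0 : TDir d n (L * M)), Near (chart skewP (L * M) V θ))
    (hmin : ∀ U : Site d → Fin d → (Matrix n n ℂ)ˣ, IsUnitaryCfg U → IsPeriodicCfg U ((L : ℤ) * M) → Near U →
      (∀ g ∈ 𝒦, gaugeAct g U = U) → Q (cavg L U) = Q (cavg L V) →
        fineAction V (blockWindow L (periodBox M)).2 ≤ fineAction U (blockWindow L (periodBox M)).2)
    {ψ : Site d → Fin d → Matrix n n ℂ} (hψs : IsSkewDir ψ) (hψP : IsPeriodicDir ψ ((L : ℤ) * M))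
    (hψK : ∀ g ∈ 𝒦, (fun y μ => Ad (g (y + e μ)) (ψ y μ)) = ψ)
    (hTc : Q' (resDir M (fun y κ => pushDir L V ψ ((L : ℤ) • y) κ)) = 0) :
    HasDerivAt (fun s : ℝ => fineAction (vary V ψ s) (blockWindow L (periodBox M)).2) 0 0 := by
  classical
  have hL : 1 ≤ L := Nat.one_le_iff_ne_zero.mpr (NeZero.ne L)
  have h512 : 512 * (d + 1) * (d + 4) * (L : ℝ) ^ 2 * a ≤ 1 := small512_of_liftSmall hL ha hsmall
  have hW : ∀ (q : Site d) (κ : Fin d) (r : Fin d → Fin L), ‖((Wcx L V q κ (boxVec L r) : (Matrix n n ℂ)ˣ) : Matrix n n ℂ) - 1‖ < 1 :=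
    norm_Wcx_sub_one_lt_one_of_smallField L hL hV ha h512 hVa
  have hVP' : IsPeriodicCfg V ((L * M : ℕ) : ℤ) := by rw [natCast_mul_period]; exact hVP
  set Wf := (blockWindow L (periodBox (d := d) M)).2 with hWf
  -- the chart action and the chart constraint (as in NE3-R2)
  set A : TDir d n (L * M) → ℝ := fun θ => fineAction (chart skewP (L * M) V θ) Wf with hA
  set F : TDir d n (L * M) → G := fun θ => Q (cavg L (chart skewP (L * M) V θ)) with hF
  have hAd : HasStrictFDerivAt A (fderiv ℝ A 0) 0 :=
    (contDiffAt_fineAction_chart (m := 1) skewP (L * M) V Wf 0).hasStrictFDerivAt one_ne_zero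
  have hcoord : HasStrictFDerivAt (coord skewP L M V) (fderiv ℝ (coord skewP L M V) 0) 0 :=
    (contDiffAt_coord (m := 1) skewP L M V hW).hasStrictFDerivAt one_ne_zero
  have hQ0 : HasStrictFDerivAt (fun Φ : TDir d n M => Q (chart (ContinuousLinearMap.id ℝ (Matrix n n ℂ)) M (cavg L V) Φ)) Q'
      (coord skewP L M V 0) := by
    rw [coord_zero]; exact hQ
  set F' : TDir d n (L * M) →L[ℝ] G := Q'.comp (fderiv ℝ (coord skewP L M V) 0) with hF'
  have hFd : HasStrictFDerivAt F F' 0 := by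
    refine (hQ0.comp 0 hcoord).congr_of_eventuallyEq ?_
    exact (eventually_cavg_chart_eq hL hV hVP ha h512 hVa).mono fun θ hθ => by
      simp only [hF, hθ]
  -- the differential of the constraint is onto (the periodic face lift)
  have hsurj : Function.Surjective F' := by
    intro γ
    obtain ⟨Φ, hΦs, hΦ⟩ := hQ' γ
    have hφP : ∀ (y : Site d) (j κ : Fin d), extDir M Φ (y + (M : ℤ) • e j) κ = extDir M Φ y κ :=
      fun y j κ => isPeriodicDir_extDir M Φ y j κ
    obtain ⟨χ, hχF, hχP, hχpush, -, hχs⟩ := exists_lift_periodic hL hV hVP ha hsmall hVa (extDir M Φ) hφP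
    have hχskew : IsSkewDir χ := hχs fun y κ => hΦs _ _
    have hχP' : IsPeriodicDir χ ((L * M : ℕ) : ℤ) := by rw [natCast_mul_period]; exact hχP
    refine ⟨resDir (L * M) χ, ?_⟩
    rw [hF', ContinuousLinearMap.comp_apply, ← hΦ]
    congr 1
    funext r κ
    rw [fderiv_coord_apply skewP L M V hW, chartDir_skewP_resDir (L * M) hχP' hχskew, hχpush]
    simp only [extDir, redN_boxVec]
  -- THE DRESSING of the chart parameter, as linear maps, and the fixed subspace `E^𝒦`
  let Sₗ : ↥𝒦 → TDir d n (L * M) →ₗ[ℝ] TDir d n (L * M) := fun g =>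
    { toFun := fun θ => fun r κ => Ad ((g : Site d → (Matrix n n ℂ)ˣ) (boxVec (L * M) r + e κ)) (θ r κ)
      map_add' := fun θ θ' => by funext r κ; simp only [Pi.add_apply, Ad_add]
      map_smul' := fun c θ => by funext r κ; simp only [Pi.smul_apply, Ad_real_smul, RingHom.id_apply] }
  have hSₗ : ∀ (g : ↥𝒦) (θ : TDir d n (L * M)), Sₗ g θ = fun r κ => Ad ((g : Site d → (Matrix n n ℂ)ˣ) (boxVec (L * M) r + e κ)) (θ r κ) :=
    fun g θ => rfl
  let S : ↥𝒦 → TDir d n (L * M) →L[ℝ] TDir d n (L * M) := fun g => LinearMap.toContinuousLinearMap (Sₗ g)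
  have hS : ∀ (g : ↥𝒦) (θ : TDir d n (L * M)), S g θ = fun r κ => Ad ((g : Site d → (Matrix n n ℂ)ˣ) (boxVec (L * M) r + e κ)) (θ r κ) :=
    fun g θ => rfl
  set EK : Submodule ℝ (TDir d n (L * M)) := ⨅ g : ↥𝒦, LinearMap.ker ((Sₗ g) - LinearMap.id) with hEK
  have hmemEK : ∀ θ : TDir d n (L * M), θ ∈ EK ↔ ∀ g : ↥𝒦, S g θ = θ := fun θ => by
    simp only [hEK, Submodule.mem_iInf, LinearMap.mem_ker, LinearMap.sub_apply, LinearMap.id_apply, sub_eq_zero]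
    exact Iff.rfl
  haveI : CompleteSpace ↥EK := FiniteDimensional.complete ℝ _
  -- the fixed subspace `G^𝒦` and a linear projection onto it
  set GK : Submodule ℝ G := ⨅ g : ↥𝒦, LinearMap.ker (((R g : G →L[ℝ] G) : G →ₗ[ℝ] G) - LinearMap.id) with hGK
  have hmemGK : ∀ γ : G, γ ∈ GK ↔ ∀ g : ↥𝒦, R g γ = γ := fun γ => by
    simp only [hGK, Submodule.mem_iInf, LinearMap.mem_ker, LinearMap.sub_apply, LinearMap.id_apply, sub_eq_zero,
      ContinuousLinearMap.coe_coe]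
  haveI : CompleteSpace ↥GK := FiniteDimensional.complete ℝ _
  obtain ⟨GK', hGK'⟩ := GK.exists_isCompl
  let P : G →L[ℝ] ↥GK := LinearMap.toContinuousLinearMap (Submodule.projectionOnto GK GK' hGK')
  have hP : ∀ x : ↥GK, P (x : G) = x := fun x => Submodule.projectionOnto_apply_left hGK' x
  -- the restricted maps
  let ι : ↥EK →L[ℝ] TDir d n (L * M) := EK.subtypeL
  have hι0 : ι 0 = 0 := map_zero ι
  set f : ↥EK → ↥GK := fun θ => P (F (ι θ)) with hf
  set φ : ↥EK → ℝ := fun θ => A (ι θ) with hφ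
  have hφd : HasStrictFDerivAt φ ((fderiv ℝ A 0).comp ι) 0 := by
    have h := hAd
    rw [← hι0] at h
    exact h.comp 0 ι.hasStrictFDerivAt
  have hfd : HasStrictFDerivAt f (P.comp (F'.comp ι)) 0 := by
    have h := hFd
    rw [← hι0] at h
    exact P.hasStrictFDerivAt.comp 0 (h.comp 0 ι.hasStrictFDerivAt)
  -- pulled-back eventualities along `ι`
  have hιt : Tendsto (fun θ : ↥EK => ι θ) (𝓝 0) (𝓝 0) := by
    have h := ι.continuous.tendsto 0
    rwa [hι0] at h
  have hQRK : ∀ᶠ θ : ↥EK in 𝓝 0, F (ι θ) ∈ GK := by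
    filter_upwards [hιt.eventually hQR] with θ hθ
    rw [hmemGK]
    intro g
    have h1 := hθ g g.2
    have h2 : (fun r κ => Ad ((g : Site d → (Matrix n n ℂ)ˣ) (boxVec (L * M) r + e κ)) ((ι θ) r κ)) = ι θ := by
      rw [← hS]; exact (hmemEK _).1 θ.2 g
    rw [h2] at h1
    exact h1.symm
  -- the local minimum on the restricted level set
  have hloc : IsLocalMinOn φ {θ | f θ = f 0} 0 := by
    refine eventually_nhdsWithin_iff.mpr ?_
    filter_upwards [hιt.eventually hNear, hQRK] with θ hθN hθG hθf
    simp only [hf] at hθf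
    have hF0 : F (ι 0) ∈ GK := by
      rw [hι0, hmemGK]; intro g
      simp only [hF, chart_zero]
      have h0 := hQR.self_of_nhds g g.2
      have hz : (fun r κ => Ad ((g : Site d → (Matrix n n ℂ)ˣ) (boxVec (L * M) r + e κ)) ((0 : TDir d n (L * M)) r κ)) = 0 := by
        funext r κ; simp only [Pi.zero_apply, Ad_zero]
      rw [hz, chart_zero] at h0
      exact h0.symm
    have hFeq : F (ι θ) = F (ι 0) := by
      have h1 : ((P (F (ι θ)) : ↥GK) : G) = ((P (F (ι 0)) : ↥GK) : G) := by rw [hθf]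
      rwa [show P (F (ι θ)) = ⟨F (ι θ), hθG⟩ from hP ⟨_, hθG⟩, show P (F (ι 0)) = ⟨F (ι 0), hF0⟩ from hP ⟨_, hF0⟩] at h1
    rw [hι0] at hFeq
    simp only [hF, chart_zero] at hFeq
    show A (ι 0) ≤ A (ι θ)
    rw [hι0]
    simp only [hA, chart_zero]
    have hθP : IsPeriodicCfg (chart skewP (L * M) V (ι θ)) ((L : ℤ) * M) := by
      have h := isPeriodicCfg_chart skewP (L * M) hVP' (ι θ)
      rw [natCast_mul_period] at h
      exact h
    have hθfix : ∀ g ∈ 𝒦, gaugeAct g (chart skewP (L * M) V (ι θ)) = chart skewP (L * M) V (ι θ) := by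
      intro g hg
      rw [← chart_dress (L * M) (h𝒦u g hg) (h𝒦P g hg) (h𝒦fix g hg), ← hS ⟨g, hg⟩,
        show S ⟨g, hg⟩ (ι θ) = ι θ from (hmemEK _).1 θ.2 ⟨g, hg⟩]
    exact hmin _ (isUnitaryCfg_chart (L * M) hV (ι θ)) hθP hθN hθfix hFeq
  -- equivariance of the differential `F'` (uniqueness of derivatives under the eventual equivariance of `F`)
  have hequiv : ∀ (g : ↥𝒦) (θ : TDir d n (L * M)), F' (S g θ) = R g (F' θ) := by
    intro g θ
    have h1 : HasFDerivAt (fun θ => F (S g θ)) (F'.comp (S g)) 0 := by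
      have h := hFd.hasFDerivAt
      rw [← show S g 0 = 0 from map_zero (S g)] at h
      exact h.comp 0 (S g).hasFDerivAt
    have h2 : HasFDerivAt (fun θ => R g (F θ)) ((R g : G →L[ℝ] G).comp F') 0 :=
      (R g).hasFDerivAt.comp 0 hFd.hasFDerivAt
    have h3 : HasFDerivAt (fun θ => R g (F θ)) (F'.comp (S g)) 0 := by
      refine h1.congr_of_eventuallyEq ?_
      filter_upwards [hQR] with θ' hθ'
      have := hθ' g g.2
      simp only [hF, hS]
      exact this.symm
    have heq := h3.unique h2
    have := congrArg (fun T : TDir d n (L * M) →L[ℝ] G => T θ) heq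
    simpa only [ContinuousLinearMap.comp_apply] using this
  -- the restricted differential is onto `G^𝒦`
  have hsurjK : Function.Surjective (P.comp (F'.comp ι)) := by
    intro γ
    -- the Frobenius form on the chart parameters
    let BE : TDir d n (L * M) →ₗ[ℝ] TDir d n (L * M) →ₗ[ℝ] ℝ :=
      LinearMap.mk₂ ℝ (fun θ θ' => ∑ r : Fin d → Fin (L * M), ∑ κ : Fin d, hsR (θ r κ) (θ' r κ))
        (fun θ₁ θ₂ θ' => by simp only [Pi.add_apply, hsR_add_left, sum_add_distrib])
        (fun c θ θ' => by simp only [Pi.smul_apply, hsR_smul_left, mul_sum, smul_eq_mul])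
        (fun θ θ₁ θ₂ => by simp only [Pi.add_apply, hsR_add_right, sum_add_distrib])
        (fun c θ θ' => by simp only [Pi.smul_apply, hsR_smul_right, mul_sum, smul_eq_mul])
    have hBE : ∀ θ θ' : TDir d n (L * M), BE θ θ' = ∑ r : Fin d → Fin (L * M), ∑ κ : Fin d, hsR (θ r κ) (θ' r κ) := fun _ _ => rfl
    have hBEpos : ∀ θ : TDir d n (L * M), θ ≠ 0 → 0 < BE θ θ := by
      intro θ hθ
      rw [hBE]
      have hnn : ∀ r ∈ (univ : Finset (Fin d → Fin (L * M))), 0 ≤ ∑ κ : Fin d, hsR (θ r κ) (θ r κ) :=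
        fun r _ => sum_nonneg fun κ _ => by rw [hsR_self]; exact nhsNormSq_nonneg _
      rcases (sum_nonneg hnn).lt_or_eq with hlt | heq
      · exact hlt
      · exfalso; apply hθ
        funext r κ
        have h1 := (sum_eq_zero_iff_of_nonneg hnn).1 heq.symm r (mem_univ _)
        have h2 := (sum_eq_zero_iff_of_nonneg (fun κ _ => by rw [hsR_self]; exact nhsNormSq_nonneg _)).1 h1 κ (mem_univ _)
        rw [hsR_self] at h2
        exact eq_zero_of_nhsNormSq_eq_zero h2
    have hSiso : ∀ (g : ↥𝒦) (θ θ' : TDir d n (L * M)), BE (Sₗ g θ) (Sₗ g θ') = BE θ θ' := by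
      intro g θ θ'
      rw [hBE, hBE]
      refine sum_congr rfl fun r _ => sum_congr rfl fun κ _ => ?_
      rw [hSₗ, hSₗ]
      exact hsR_Ad (h𝒦u g g.2 _) _ _
    obtain ⟨Φ, hΦS, hΦT⟩ := exists_fixed_preimage_of_equivariant BE hBEpos BG hBG Sₗ (fun g => ((R g : G →L[ℝ] G) : G →ₗ[ℝ] G))
      hSiso (fun g γ₁ γ₂ => hR g g.2 γ₁ γ₂) (F' : TDir d n (L * M) →ₗ[ℝ] G) hsurj (fun g θ => hequiv g θ) (γ : G)
      (fun g => (hmemGK _).1 γ.2 g)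
    refine ⟨⟨Φ, (hmemEK Φ).2 hΦS⟩, ?_⟩
    rw [ContinuousLinearMap.comp_apply, ContinuousLinearMap.comp_apply]
    have h1 : F' (ι ⟨Φ, (hmemEK Φ).2 hΦS⟩) = (γ : G) := hΦT
    rw [h1, hP]
  -- the invariant tangent direction as a kernel element of the restricted differential
  have hψP' : IsPeriodicDir ψ ((L * M : ℕ) : ℤ) := by rw [natCast_mul_period]; exact hψP
  have hker : F' (resDir (L * M) ψ) = 0 := by
    rw [hF', ContinuousLinearMap.comp_apply]
    have e1 : (fderiv ℝ (coord skewP L M V) 0) (resDir (L * M) ψ) = resDir M (fun y κ => pushDir L V ψ ((L : ℤ) • y) κ) := by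
      funext r κ
      rw [fderiv_coord_apply skewP L M V hW, chartDir_skewP_resDir (L * M) hψP' hψs]
      rfl
    rw [e1]
    exact hTc
  have hvK : resDir (L * M) ψ ∈ EK := by
    rw [hmemEK]
    intro g
    rw [hS]
    funext r κ
    have h := congr_fun (congr_fun (hψK g g.2) (boxVec (L * M) r)) κ
    simpa only [resDir] using h
  have hv : (P.comp (F'.comp ι)) ⟨resDir (L * M) ψ, hvK⟩ = 0 := by
    rw [ContinuousLinearMap.comp_apply, ContinuousLinearMap.comp_apply]
    have h1 : F' (ι ⟨resDir (L * M) ψ, hvK⟩) = 0 := hker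
    rw [h1, map_zero]
  have hzero := fermat_of_submersion hloc hfd hφd hsurjK hv
  have hzero' : (fderiv ℝ A 0) (resDir (L * M) ψ) = 0 := hzero
  have hder := hasDerivAt_fineAction_chartDir skewP (L * M) V Wf (resDir (L * M) ψ)
  rw [chartDir_skewP_resDir (L * M) hψP' hψs] at hder
  rw [show fderiv ℝ (fun ψ' : TDir d n (L * M) => fineAction (chart skewP (L * M) V ψ') Wf) 0 = fderiv ℝ A 0 from rfl, hzero'] at hder
  exact hder

end

end Summit.QuantumFields.BalabanUV.T4Continuum.NE7SymmetricFermat
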